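import Summits.HodgeConjecture.HodgeConjecture.Theorems.P2StubU2OfLettersFinal
import Summits.HodgeConjecture.HodgeConjecture.Theorems.H413SpectrumInterfacesKernel
import Summits.HodgeConjecture.HodgeConjecture.Theorems.P2StubU1RealisationAt
import Summits.HodgeConjecture.HodgeConjecture.Theorems.P2StubU4OfDictionary
import Literature.NumberTheory.Automorphic.UnitaryGroupCotangentSpectralProjectionConj
import HarnessLib

/-!
# Crux `H413`, programme P2 — THE CRUX `HCCMUnconditional.H413` BY NAME FROM THE P2 SOCKETS (floor-0 steady state) and the rows of P3 and P4

Cell hodgecm-mathlib (D-0151), FLOOR 0, crux item H413 = stmt-HodgeConjecture-24833; programme P2, parent line of record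
`Cruxes/H413/Lines/P2ThetaDictionaryExists.lean` v4a (2c346c57; sorries = the five class-U sockets {C, C′, D, D̄, U4}).  Author F0P2-p01 (g2) on
F0P2-plan (g0)'s STANDING WORD (1) of 2026-08-30T23:17:49Z.  THEOREMS ONLY (no definition, no instance, no named fact, no `sorry`);
`--supports stmt-HodgeConjecture-24833 --as helper`.  HC_CM is proved only modulo the 7 printed citations until rung 0 closes; this file proves nothing about
them — it is the ONE kernel term exhibiting the crux as a function of EXACTLY the open sockets.

* `H413_of_sockets (hC) (hC′) (hD) (hD′) (hU4) (hJ3a) (hocc) : HCCMUnconditional.H413` — the planner's shape: sockets (C) ★ `Rogawski1990.cohFinComponent_isTheta`,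
  (C′) ★ `Def411WeilCarriers.rhoAtLine_lineClassTransport`, (D)∕(D̄) ★ `CotangentForms.holCotFormSpectralProjection` ∕ `antiholCotFormSpectralProjection`, U4
  `SpectrumInterfaces.StubU4SignRule` (the registered stub; = E3 ∧ ★ G4, ★ `P2StubU4OfParity`), and the floor rows `HJ3aType` (P3), `HoccType` (P4).  Term:
  ★ `Hyp413Closing.H413_of_three_facts_flat` ∘ ★ `oscillatorTriple_dictionaryExistence_holds_of` at U1′ := ★ `TowerRealisation.stubU1RealisationAt_holds` (p792926),
  U2′ := ★ `P2StubU2OfLettersFinal.stub_U2_cohFormsSpectrumIsThetaAt_of_letters hC hC′ hD hD′` (p793962, over p793253 + p793582).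
* `H413_of_sockets'` — the same WITHOUT `hD′`: (D̄) is (D) (★ `CotangentForms.antiholCotFormSpectralProjection_of_hol`, p794879).  Hole census read off the
  signature: {C, C′, D, U4} + P3's `hJ3a` + P4's `hocc`.
* `hdictE_of_sockets'` — the floor row `hdictE` alone from {C, C′, D, U4}.

## References
* [Liu2021] Y. Liu, Camb. J. Math. 9 (2021) = arXiv:2102.11518: Prop. 4.13 and proof l. 2121–2146; Rem. 4.14; Def. 4.11–4.12; App. D Lem. D.1, D.2 (2).
* [GelbartRogawski1991] Invent. Math. 105 (1991), Introduction pp. 446–448; Thm. 5.1.1; Lem. 5.1.2.  [Rogawski1990] Thm. 13.3.1, 13.3.6 (c), §14.6, §15.3.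
* [Rogawski1992] Thm. 1.1.  [BorelJacquet1979] §4.6.  [BorelWallach2000] VII 2.10, 3.2.
-/

set_option autoImplicit false

-- the mandated namespace has the single-problem summit's repeated segment (`HodgeConjecture.HodgeConjecture`)
set_option linter.dupNamespace false

noncomputable section

namespace Summit.HodgeConjecture.HodgeConjecture.Cruxes.H413.P2H413OfSockets

open Literature.NumberTheory.Automorphic.UnitaryGroup.CotangentForms (holCotFormSpectralProjection antiholCotFormSpectralProjection
  antiholCotFormSpectralProjection_of_hol)
open Summit.HodgeConjecture.HodgeConjecture.Cruxes.H413.SpectrumInterfaces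

set_option synthInstance.maxHeartbeats 400000 in
set_option maxHeartbeats 8000000 in
/-- **The floor row `hdictE` from the P2 sockets {C, C′, D, D̄, U4}** (U1′ ★ inside): ★ `oscillatorTriple_dictionaryExistence_holds_of` at U1′ := ★
`TowerRealisation.stubU1RealisationAt_holds` and U2′ := ★ `P2StubU2OfLettersFinal.stub_U2_cohFormsSpectrumIsThetaAt_of_letters hC hC′ hD hD′`.
[cite: Liu2021, proof of Prop. 4.13, l. 2145; Rem. 4.14] [cite: GelbartRogawski1991, Introduction p. 448 L30–33; Thm 5.1.1 p. 465] -/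
theorem hdictE_of_sockets (hC : Literature.NumberTheory.Rogawski1990.cohFinComponent_isTheta)
    (hC' : Literature.NumberTheory.Automorphic.Liu2021.Def411WeilCarriers.rhoAtLine_lineClassTransport)
    (hD : holCotFormSpectralProjection) (hD' : antiholCotFormSpectralProjection) (hU4 : StubU4SignRule) : HdictEType :=
  oscillatorTriple_dictionaryExistence_holds_of TowerRealisation.stubU1RealisationAt_holds
    (P2StubU2OfLettersFinal.stub_U2_cohFormsSpectrumIsThetaAt_of_letters hC hC' hD hD') hU4

set_option synthInstance.maxHeartbeats 400000 in
set_option maxHeartbeats 8000000 in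
/-- **THE CRUX `HCCMUnconditional.H413` BY NAME FROM THE P2 SOCKETS {C, C′, D, D̄, U4} AND THE ROWS `hJ3a` (P3), `hocc` (P4)** — F0P2-plan (g0)'s shape
(STANDING WORD (1), 2026-08-30T23:17:49Z): ★ `Hyp413Closing.H413_of_three_facts_flat` over `hdictE_of_sockets`.  This is the head the line audit of crux item
stmt-HodgeConjecture-24833 reads. [cite: Liu2021, Prop. 4.13 and proof l. 2121–2146; Rem. 4.14] [cite: GelbartRogawski1991, Introduction p. 448; Thm 5.1.1]
[cite: Rogawski1990, Thm. 13.3.1, Thm. 13.3.6] [cite: Rogawski1992, Thm. 1.1] -/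
theorem H413_of_sockets (hC : Literature.NumberTheory.Rogawski1990.cohFinComponent_isTheta)
    (hC' : Literature.NumberTheory.Automorphic.Liu2021.Def411WeilCarriers.rhoAtLine_lineClassTransport)
    (hD : holCotFormSpectralProjection) (hD' : antiholCotFormSpectralProjection) (hU4 : StubU4SignRule)
    (hJ3a : HJ3aType) (hocc : HoccType) : Summit.HodgeConjecture.HodgeConjecture.Theses.HCCMUnconditional.H413 :=
  Summit.HodgeConjecture.CorCM.Hyp413Closing.H413_of_three_facts_flat (hdictE_of_sockets hC hC' hD hD' hU4) hJ3a hocc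

set_option synthInstance.maxHeartbeats 400000 in
set_option maxHeartbeats 8000000 in
/-- **`hdictE` from {C, C′, D, U4} only** — the antiholomorphic projection letter (D̄) IS the holomorphic one (★ `antiholCotFormSpectralProjection_of_hol`, complex
conjugation of discrete summands). [cite: Liu2021, proof of Prop. 4.13, l. 2145; Rem. 4.14] [cite: BorelWallach2000, VII 2.10] [cite: BorelJacquet1979, §4.6] -/
theorem hdictE_of_sockets' (hC : Literature.NumberTheory.Rogawski1990.cohFinComponent_isTheta)
    (hC' : Literature.NumberTheory.Automorphic.Liu2021.Def411WeilCarriers.rhoAtLine_lineClassTransport)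
    (hD : holCotFormSpectralProjection) (hU4 : StubU4SignRule) : HdictEType :=
  hdictE_of_sockets hC hC' hD (antiholCotFormSpectralProjection_of_hol hD) hU4

set_option synthInstance.maxHeartbeats 400000 in
set_option maxHeartbeats 8000000 in
/-- **THE CRUX FROM {C, C′, D, U4} + `hJ3a` + `hocc`** — P2's floor-0 hole census read off a signature: four P2 sockets, no (D̄).
[cite: Liu2021, Prop. 4.13 and proof l. 2121–2146; Rem. 4.14] [cite: GelbartRogawski1991, Introduction p. 448; Thm 5.1.1] [cite: Rogawski1990, Thm. 13.3.1, Thm. 13.3.6]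
[cite: Rogawski1992, Thm. 1.1] [cite: BorelWallach2000, VII 2.10] -/
theorem H413_of_sockets' (hC : Literature.NumberTheory.Rogawski1990.cohFinComponent_isTheta)
    (hC' : Literature.NumberTheory.Automorphic.Liu2021.Def411WeilCarriers.rhoAtLine_lineClassTransport)
    (hD : holCotFormSpectralProjection) (hU4 : StubU4SignRule)
    (hJ3a : HJ3aType) (hocc : HoccType) : Summit.HodgeConjecture.HodgeConjecture.Theses.HCCMUnconditional.H413 :=
  H413_of_sockets hC hC' hD (antiholCotFormSpectralProjection_of_hol hD) hU4 hJ3a hocc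

end Summit.HodgeConjecture.HodgeConjecture.Cruxes.H413.P2H413OfSockets

end
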